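import Mathlib
import HarnessLib
import Summits.HubbardSuperconductivity.HubbardSuperconductivity.Theorems.KLProgrammeH10TwoPointLimitKlAnisoTightBundleCount
import Summits.HubbardSuperconductivity.HubbardSuperconductivity.Theorems.KLProgrammeKLRegimeCountertermFrameCurveLipschitz

/-!
# Route `KLProgramme` — K3 engine (stmt-HubbardSuperconductivity-20437), stub (b) (ℓ)/(I2), located item «ON-CLASS-KB» (K):
# the tight-bundle count SPECIALISED TO THE FRAME'S CURVE `θ ↦ klFermiPoint μ K θ`

Cell gate-hubbard-kl, seat p4 g13.  `…KlAnisoTightBundleCount.card_tightBundle_target_le` is stated for an abstract polar, centrally symmetric,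
torus-Lipschitz centre map `P`.  Here the three hypotheses are discharged for the frame's Fermi point:
polar with radius `u_K(θ) ≥ u_min` (k3c3-p3's `umin_le_frameRadius`), central symmetry (as in `klFermiPoint_add_pi`), and torus-Lipschitz from the
sup-norm Lipschitz bound `norm_klFermiPoint_sub_le` (constant `π√2·(1 + (4 + 2A)/(Dt_min − 2A))`) plus `2π`-periodicity.

* `abs_apply_sub_le_mul_torusDist_of_periodic` — periodic + Lipschitz (sup norm, `|θ − θ′|`) ⇒ coordinatewise Lipschitz for the torus distance;
* `card_tightBundle_target_le_frame` — the count for a frame of `C²` size `A` on a band window (`2A < Dt_min`);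
* **`card_tightBundle_target_le_window`** — for every renormalisation package `R` there are thresholds `c₃, U₀ > 0` and constants `Λ ≥ 0`, `r₀ > 0`
  (window/package constants, NOT depending on volume, `β`, `U`, the frame or the scale) such that for every admissible frame
  (`FrameOK R U (nScales β) ν K`, `μ ∈ klWindowC`) the tight-bundle class at scale `k` has `≤ (4π(4C + 2ΛC′)/r₀ + 2)·(4(2C′+1))^m` members.
PROVED; no definitions, no named facts; nothing here asserts anything about the model or superconductivity. [folklore] counting.
-/

noncomputable section

namespace Summit.HubbardSuperconductivity.HubbardSuperconductivity.Theorems.PerturbedFermiCurve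

set_option linter.dupNamespace false -- summit = problem name (single-conjunct summit), D-0017

open Classical
open Real Set Finset
open Literature.MathematicalPhysics.QuantumLattice Literature.MathematicalPhysics.QuantumLattice.BandSectorCounting
open Literature.MathematicalPhysics.QuantumLattice.FermiRG Literature.MathematicalPhysics.QuantumLattice.FermiRG.BGM2003
open Summit.HubbardSuperconductivity.HubbardSuperconductivity.Theorems.DispersionFlow
open Summit.HubbardSuperconductivity.HubbardSuperconductivity.Theorems.KLRegimeSplit

/-! ## §1 Periodic + Lipschitz ⇒ torus-Lipschitz -/

/-- A `2π`-periodic map `P : ℝ → ℝ²` that is `Λ`-Lipschitz in the sup norm for `|θ − θ′|` is coordinatewise `Λ`-Lipschitz for the torus distance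
`‖θ − θ′‖_{𝕋¹}`. [folklore] -/
theorem abs_apply_sub_le_mul_torusDist_of_periodic {P : ℝ → (Fin 2 → ℝ)} {Λ : ℝ} (hper : Function.Periodic P (2 * π))
    (hL : ∀ θ θ' : ℝ, ‖P θ - P θ'‖ ≤ Λ * |θ - θ'|) (θ θ' : ℝ) (j : Fin 2) :
    |P θ j - P θ' j| ≤ Λ * FermiRG.torusDist (θ - θ') := by
  obtain ⟨n, hn⟩ := exists_torusDist_eq_abs (θ - θ')
  have hP : P (θ' - n * (2 * π)) = P θ' := hper.sub_int_mul_eq n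
  calc |P θ j - P θ' j| ≤ ‖P θ - P θ'‖ := by
        rw [← Real.norm_eq_abs]; exact norm_le_pi_norm (P θ - P θ') j
    _ = ‖P θ - P (θ' - n * (2 * π))‖ := by rw [hP]
    _ ≤ Λ * |θ - (θ' - n * (2 * π))| := hL _ _
    _ = Λ * FermiRG.torusDist (θ - θ') := by rw [hn]; congr 1; ring_nf

/-! ## §2 The count for one frame -/

section Frame

variable {a b : ℝ} (B : BandBounds a b) {K : TrigPolyC4v} {A : ℝ}
  (hA : ∀ p : Momentum, ∀ j ≤ 2, ‖iteratedFDeriv ℝ j (frameShift K) p‖ ≤ A) {μ : ℝ} (hlo : a ≤ μ - A) (hhi : μ + A ≤ b)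
  (hDt : 2 * A < B.Dtmin)

include B hA hlo hhi hDt in
/-- **The tight-bundle count on the frame's curve.**  For a frame `K` of `C²` size `A` on a band window `BandBounds a b` with `[μ − A, μ + A] ⊆ [a, b]`
and `2A < Dt_min`: the coarse tuples `σ′` (scale `k`, `m + 1 ≥ 2` legs) with `σ′ p = ℓ`, signed curve centre points summing to within `(m+1)·C·w_k`
of `2πG₀`, and all non-pinned half-turned indices within `C′` (cyclically) of a common sector number at most
`(4π(4C + 2·Lip_A·C′)/u_min + 2)·(4(2C′+1))^m`, `Lip_A = π√2(1 + (4+2A)/(Dt_min − 2A))` — uniformly in `k`. [folklore] -/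
theorem card_tightBundle_target_le_frame {k m : ℕ} (hm : 1 ≤ m) (p : Fin (m + 1)) (ℓ : SectorLeg (sectorCount k)) (G₀ : Fin 2 → ℤ)
    {C : ℝ} (hC : 0 ≤ C) (C' : ℕ) :
    (((univ : Finset (Fin (m + 1) → SectorLeg (sectorCount k))).filter fun σ' =>
        σ' p = ℓ ∧
        (∀ j : Fin 2, |∑ i, (if (σ' i).2 = 0 then klFermiPoint μ K (sectorCenter k (σ' i).1.1) j
            else -klFermiPoint μ K (sectorCenter k (σ' i).1.1) j) - 2 * π * (G₀ j : ℝ)| ≤ ((m : ℝ) + 1) * C * sectorWidth k) ∧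
        ∃ b : Fin (sectorCount k), ∀ i, i ≠ p → ∃ D : ℤ, |D| ≤ C' ∧ (sectorCount k : ℤ) ∣
          ((((if (σ' i).2 = 0 then ((σ' i).1.1 : ℕ) else
              if ((σ' i).1.1 : ℕ) < 2 ^ k then ((σ' i).1.1 : ℕ) + 2 ^ k else ((σ' i).1.1 : ℕ) - 2 ^ k : ℕ) : ℤ)) - b - D)).card : ℝ) ≤
      (4 * π * (4 * C + 2 * (π * Real.sqrt 2 * (1 + (4 + 2 * A) / (B.Dtmin - 2 * A))) * C') / B.umin + 2) *
        (4 * (2 * (C' : ℝ) + 1)) ^ m := by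
  have hA0 : 0 ≤ A := le_trans (norm_nonneg _) (hA 0 0 (by norm_num))
  have hLip0 : 0 ≤ π * Real.sqrt 2 * (1 + (4 + 2 * A) / (B.Dtmin - 2 * A)) := by
    have : 0 ≤ (4 + 2 * A) / (B.Dtmin - 2 * A) := div_nonneg (by linarith) (by linarith)
    positivity
  have hper : Function.Periodic (klFermiPoint μ K) (2 * π) := fun θ => by
    unfold klFermiPoint; rw [perturbedFermiRadius_add_two_pi, dir_add_two_pi]
  have hpolar : ∀ θ : ℝ, ∃ r : ℝ, B.umin ≤ r ∧ klFermiPoint μ K θ = r • dir θ :=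
    fun θ => ⟨_, umin_le_frameRadius B hA hlo hhi θ, rfl⟩
  -- central symmetry (k3c3-p3's `klFermiPoint_add_pi`, re-proved inline to keep the imports light)
  have hanti : ∀ θ : ℝ, klFermiPoint μ K (θ + π) = -klFermiPoint μ K θ := fun θ => by
    unfold klFermiPoint
    rw [perturbedFermiRadius_add_pi (fun k => by simp [TrigPolyC4v.eval_neg]) μ θ, dir_add_pi, smul_neg]
  exact card_tightBundle_target_le (klFermiPoint μ K) B.umin_pos hLip0 hpolar hanti
    (abs_apply_sub_le_mul_torusDist_of_periodic hper (norm_klFermiPoint_sub_le B hA hlo hhi hDt)) hm p ℓ G₀ hC C'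

end Frame

/-! ## §3 The count for every admissible frame on the analysis window -/

/-- **The tight-bundle count for ADMISSIBLE frames in the KL regime.**  For every renormalisation package `R` (`Gfr ≥ 0`) there are thresholds
`c₃, U₀ > 0`, a Lipschitz constant `Λ ≥ 0` and a radius `r₀ > 0` — depending on `R` and the window only — such that for `0 < c ≤ c₃`, `0 < U ≤ U₀`,
`klBetaMin ≤ β ≤ e^{c/U²}`, `μ ∈ klWindowC` and every frame with `FrameOK R U (nScales β) ν K`, at every scale `k` and for `m + 1 ≥ 2` legs, the
tight-bundle class (pinned label `ℓ` at `p`, on the umklapp class of `G₀` with tolerance `(m+1)·C·w_k`, non-pinned half-turned indices within `C′` of a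
common sector) has at most `(4π(4C + 2ΛC′)/r₀ + 2)·(4(2C′+1))^m` members. [folklore] -/
theorem card_tightBundle_target_le_window (R : RenConsts) (hR : ∀ j, 0 ≤ R.Gfr j) :
    ∃ c₃ : ℝ, 0 < c₃ ∧ ∃ U₀ : ℝ, 0 < U₀ ∧ ∃ Λ : ℝ, 0 ≤ Λ ∧ ∃ r₀ : ℝ, 0 < r₀ ∧
      ∀ c : ℝ, 0 < c → c ≤ c₃ → ∀ U : ℝ, 0 < U → U ≤ U₀ → ∀ β : ℝ, klBetaMin ≤ β → β ≤ Real.exp (c / U ^ 2) →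
      ∀ μ ∈ klWindowC, ∀ (ν : ℝ) (K : TrigPolyC4v), FrameOK R U (nScales β) ν K →
      ∀ (k m : ℕ), 1 ≤ m → ∀ (p : Fin (m + 1)) (ℓ : SectorLeg (sectorCount k)) (G₀ : Fin 2 → ℤ) (C : ℝ), 0 ≤ C → ∀ C' : ℕ,
      (((univ : Finset (Fin (m + 1) → SectorLeg (sectorCount k))).filter fun σ' =>
          σ' p = ℓ ∧
          (∀ j : Fin 2, |∑ i, (if (σ' i).2 = 0 then klFermiPoint μ K (sectorCenter k (σ' i).1.1) j
              else -klFermiPoint μ K (sectorCenter k (σ' i).1.1) j) - 2 * π * (G₀ j : ℝ)| ≤ ((m : ℝ) + 1) * C * sectorWidth k) ∧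
          ∃ b : Fin (sectorCount k), ∀ i, i ≠ p → ∃ D : ℤ, |D| ≤ C' ∧ (sectorCount k : ℤ) ∣
            ((((if (σ' i).2 = 0 then ((σ' i).1.1 : ℕ) else
                if ((σ' i).1.1 : ℕ) < 2 ^ k then ((σ' i).1.1 : ℕ) + 2 ^ k else ((σ' i).1.1 : ℕ) - 2 ^ k : ℕ) : ℤ)) - b - D)).card : ℝ) ≤
        (4 * π * (4 * C + 2 * Λ * C') / r₀ + 2) * (4 * (2 * (C' : ℝ) + 1)) ^ m := by
  -- thresholds exactly as in k3c3-p3's `frameCurve_lipschitz_of_frameOK`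
  have ha : (-4 : ℝ) < -1.1 := by norm_num
  have hab : (-1.1 : ℝ) ≤ -0.1 := by norm_num
  have hb : (-0.1 : ℝ) < 0 := by norm_num
  set B := bandBounds ha hab hb with hBdef
  have hDt := B.Dtmin_pos
  set κ : ℝ := min B.Dtmin (1 / 5) with hκdef
  have hκ : 0 < κ := lt_min hDt (by norm_num)
  obtain ⟨c₃, hc₃, U₀, hU₀, hthr⟩ := frame_thresholds hR hκ
  set Λ : ℝ := π * Real.sqrt 2 * (1 + (4 + B.Dtmin) / (B.Dtmin / 2)) with hΛdef
  have hΛ0 : 0 ≤ Λ := by positivity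
  refine ⟨c₃, hc₃, U₀, hU₀, Λ, hΛ0, B.umin, B.umin_pos, ?_⟩
  intro c hc hcle U hU hUle β hβmin hβc μ hμ ν K hK k m hm p ℓ G₀ C hC C'
  have hAf : ∀ p : Momentum, ∀ j ≤ 2, ‖iteratedFDeriv ℝ j (frameShift K) p‖ ≤
      2 * R.Gfr 0 * |U| + 2 * R.Gfr 1 * U ^ 2 + R.Gfr 2 * (c / Real.log 4) := fun p j hj =>
    norm_iteratedFDeriv_frameShift_le_of_frameOK_regime hR hc.le hβmin hβc hK p hj
  set A := 2 * R.Gfr 0 * |U| + 2 * R.Gfr 1 * U ^ 2 + R.Gfr 2 * (c / Real.log 4) with hAdef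
  have h4A : 4 * A ≤ κ := hthr c U hc.le hcle hU hUle
  have hA0 : 0 ≤ A := le_trans (norm_nonneg _) (hAf 0 0 (by norm_num))
  have hκDt : κ ≤ B.Dtmin := min_le_left _ _
  have hκ5 : κ ≤ 1 / 5 := min_le_right _ _
  have hADt : 2 * A < B.Dtmin := by linarith
  have hA20 : A ≤ 1 / 20 := by linarith
  obtain ⟨hlo, hhi⟩ := PerturbedFermiCurve.klWindowC_margin hμ hA20
  have hden : B.Dtmin / 2 ≤ B.Dtmin - 2 * A := by linarith
  have hfrac : (4 + 2 * A) / (B.Dtmin - 2 * A) ≤ (4 + B.Dtmin) / (B.Dtmin / 2) := by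
    rw [div_le_div_iff₀ (by linarith) (by linarith)]
    nlinarith
  have hΛ1 : π * Real.sqrt 2 * (1 + (4 + 2 * A) / (B.Dtmin - 2 * A)) ≤ Λ := by
    rw [hΛdef]
    apply mul_le_mul_of_nonneg_left _ (by positivity)
    linarith
  have h := card_tightBundle_target_le_frame B hAf hlo hhi hADt hm p ℓ G₀ hC C'
  refine h.trans (mul_le_mul_of_nonneg_right ?_ (by positivity))
  have hu := B.umin_pos
  have hC'0 : (0 : ℝ) ≤ C' := Nat.cast_nonneg _
  have hnum : 4 * π * (4 * C + 2 * (π * Real.sqrt 2 * (1 + (4 + 2 * A) / (B.Dtmin - 2 * A))) * C') ≤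
      4 * π * (4 * C + 2 * Λ * C') := by
    have : 2 * (π * Real.sqrt 2 * (1 + (4 + 2 * A) / (B.Dtmin - 2 * A))) * C' ≤ 2 * Λ * C' := by nlinarith
    nlinarith [Real.pi_pos]
  have := div_le_div_of_nonneg_right hnum hu.le
  linarith

end Summit.HubbardSuperconductivity.HubbardSuperconductivity.Theorems.PerturbedFermiCurve

end
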